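import Summits.FinalStateConjecture.FinalStateConjecture.Theorems.SwallowTheDatumParametricKerrBurialEngine
import Summits.FinalStateConjecture.FinalStateConjecture.Theorems.SwallowTheDatumUniversalWitnessFamilyStubPlugDataPlusFromOfAux1
import Summits.FinalStateConjecture.FinalStateConjecture.Theorems.SwallowTheDatumUniversalWitnessFamilyStubPlugDataPlusFromOfAux2

/-!
# Stub `stub_plugDataPlusFrom_of` of the line `Sketch` (crux `SwallowTheDatum.UniversalWitnessFamily`,
# item stmt-FinalStateConjecture-10051) — helper file 3: the plumbing predicates of the engine, proved

In the vocabulary of `Theorems/SwallowTheDatumParametricKerrBurialEngine.lean` (everything proved; no named facts):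

* §1 `VacAt`/`VacOn` bookkeeping (locality of the vacuum constraints, `vacAt_congr_nhds`);
* §2 **`readTransplantAt_of_pos : 0 < s → 0 < τ → ReadTransplantAt G c s τ`** — the affine reading of helper file 1 and
  the global back-reading of the unit-scale datum as the transplant;
* §3 **`motHyp_congr`** — the hypothesis block `MOTHyp` of Mao–Oh–Tao Thm 1.7 only reads the in-fields near `{1 ≤ |x| ≤ 2}` and
  the out-fields near `{32 ≤ |x| ≤ 64}` (helper file 2);
* §4 the flat in-core: `FlatVacuumDatum F` has `coordH = flatField`, `coordK = zeroField`, and a Schwarzschild OUT-site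
  (`SchwOutSite`) accepts it with `sIn = 0`;
* §5 **patching finitely many disjoint balls** into a datum on `ℝ³` (`exists_patch_balls`, from the local-model gluing of
  helper file 1).

References: Bartnik–Isenberg 2004, §2; Mao–Oh–Tao arXiv:2308.13031, Thm 1.7, Rem 1.11.
-/

-- the doubled `FinalStateConjecture` path component is the summit/problem naming scheme, not a mistake
set_option linter.dupNamespace false
-- instance search through the nested operator type `E3 →L[ℝ] E3 →L[ℝ] ℝ`
set_option maxSynthPendingDepth 3

noncomputable section

namespace Summit.FinalStateConjecture.FinalStateConjecture.Theorems.SwallowTheDatum.UniversalWitnessFamily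

open scoped Manifold ContDiff Topology BigOperators InnerProductSpace
open Set Filter Function Literature.Geometry.Lorentzian Literature.Geometry.Lorentzian.MaoOhTao
  Literature.Geometry.Lorentzian.InitialDataSet
open Summit.FinalStateConjecture.FinalStateConjecture.Theorems.SwallowTheDatum.ParametricKerrBurial

namespace PlugDataPlus

/-! ## §1 `VacAt`, `VacOn` -/

/-- **Locality of `VacAt`**: data with the same sections near `y` are vacuum at `y` together. [cite: BartnikIsenberg2004, §2] -/
theorem vacAt_congr_nhds {D D' : InitialDataSet (𝓡 3) E3} {y : E3} (h : ∀ᶠ z in 𝓝 y, D.SameAt D' z) :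
    VacAt D y ↔ VacAt D' y :=
  vacAt_iff_of_sameAt_nhds h

/-- `VacOn` is `VacAt` on the open annulus. [folklore] -/
theorem vacOn_iff (D : InitialDataSet (𝓡 3) E3) (a b : ℝ) :
    D.VacOn a b ↔ ∀ y : E3, a < ‖y‖ → ‖y‖ < b → VacAt D y :=
  ⟨fun h y ha hb _ ↦ h y ha hb, fun h _ y ha hb ↦ h y ha hb⟩

/-- A datum vacuum at every point is a vacuum constraint solution. [folklore] -/
theorem isVacuumConstraintSolution_of_vacAt {D : InitialDataSet (𝓡 3) E3} (h : ∀ y : E3, VacAt D y) :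
    ∀ [D.metric.HasLeviCivita], D.IsVacuumConstraintSolution :=
  fun y ↦ h y

/-- The open shell `{a < |z − c| < b}` is open. [folklore] -/
theorem isOpen_shell (c : E3) (a b : ℝ) : IsOpen {z : E3 | a < ‖z - c‖ ∧ ‖z - c‖ < b} :=
  (isOpen_lt continuous_const (continuous_id.sub continuous_const).norm).inter
    (isOpen_lt (continuous_id.sub continuous_const).norm continuous_const)

/-- The exterior `{a < |z − c|}` is open. [folklore] -/
theorem isOpen_outside (c : E3) (a : ℝ) : IsOpen {z : E3 | a < ‖z - c‖} :=
  isOpen_lt continuous_const (continuous_id.sub continuous_const).norm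

/-- The exterior `{a < |z|}` is open. [folklore] -/
theorem isOpen_outside_zero (a : ℝ) : IsOpen {z : E3 | a < ‖z‖} :=
  isOpen_lt continuous_const continuous_norm

/-! ## §2 Affine readings and transplants -/

/-- **Affine reading and transplanting** (the engine's `ReadTransplantAt`), for every centre, every scale `s > 0` and every
normalisation `τ > 0`: the reading is the affine reading of helper file 1 (`exists_read`), the transplant of a unit-scale datum
`D̂` is its global back-reading at `(−c/s, 1/s, 1/τ)`. [cite: BartnikIsenberg2004, §2] -/
theorem readTransplantAt_of_pos (G : InitialDataSet (𝓡 3) E3) (c : E3) {s τ : ℝ} (hs : 0 < s) (hτ : 0 < τ) :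
    ReadTransplantAt G c s τ := by
  obtain ⟨Gr, hGr, hGrvac⟩ := exists_read G c hs hτ
  refine ⟨Gr, hGr, fun y hy _ ↦ (hGrvac y).2 hy, fun Dhat a _ hsame ↦ ?_⟩
  obtain ⟨G', hG', hG'vac⟩ := exists_read Dhat (-(s⁻¹ • c)) (inv_pos.2 hs) (inv_pos.2 hτ)
  refine ⟨G', fun y v w ↦ ?_, fun y hy ↦ ?_, fun y hy ↦ ?_⟩
  · -- the sections of the transplant at `c + s y`
    obtain ⟨h1, h2⟩ := hG' (c + s • y) v w
    rw [unaffine_affine c hs.ne'] at h1 h2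
    rw [h1, h2]
    constructor <;> field_simp
  · -- off the ball of radius `a s` about `c` the transplant is `G`
    have hy' : a < ‖-(s⁻¹ • c) + s⁻¹ • y‖ := by
      rw [norm_unaffine c hs, lt_inv_mul_iff₀ hs, mul_comm]
      exact hy
    obtain ⟨hh, hk⟩ := hsame _ hy'
    refine ⟨?_, ?_⟩
    · ext v w
      obtain ⟨e1, -⟩ := hG' y v w
      obtain ⟨e2, -⟩ := hGr (-(s⁻¹ • c) + s⁻¹ • y) v w
      rw [affine_unaffine c hs.ne'] at e2
      have e3 : Dhat.h.inner (-(s⁻¹ • c) + s⁻¹ • y) v w = Gr.h.inner (-(s⁻¹ • c) + s⁻¹ • y) v w := by rw [hh]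
      change G'.h.inner y v w = G.h.inner y v w
      rw [e1, e3, e2]
      field_simp
    · ext v w
      obtain ⟨-, e1⟩ := hG' y v w
      obtain ⟨-, e2⟩ := hGr (-(s⁻¹ • c) + s⁻¹ • y) v w
      rw [affine_unaffine c hs.ne'] at e2
      have e3 : Dhat.k (-(s⁻¹ • c) + s⁻¹ • y) v w = Gr.k (-(s⁻¹ • c) + s⁻¹ • y) v w := by rw [hk]
      change G'.k y v w = G.k y v w
      rw [e1, e3, e2]
      field_simp
  · -- vacuum transfers from `D̂` at `y` to the transplant at `c + s y`
    have key := (hG'vac (c + s • y)).2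
    rw [unaffine_affine c hs.ne'] at key
    intro _
    exact key hy

/-! ## §3 Locality of the hypothesis block of Thm 1.7 -/

/-- **`MOTHyp` is local**: it only reads the in-fields on an open set containing `{1 ≤ |x| ≤ 2}` and the out-fields on an open set
containing `{32 ≤ |x| ≤ 64}` (deviation: iterated derivatives are local; charges: the weight `η_r` vanishes off the open annulus,
`supp η ⊆ [1, 2]`). [cite: MaoOhTao2023, Thm 1.7] -/
theorem motHyp_congr {η : ℝ → ℝ} (hη : IsBump η) {εo μo sIn sOut : ℝ}
    {gIn kIn gOut kOut gIn' kIn' gOut' kOut' : E3 → E3 →L[ℝ] E3 →L[ℝ] ℝ} {VIn VOut : Set E3}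
    (hVIn : IsOpen VIn) (hVOut : IsOpen VOut)
    (hAIn : ∀ x : E3, 1 ≤ ‖x‖ → ‖x‖ ≤ 2 → x ∈ VIn) (hAOut : ∀ x : E3, 32 ≤ ‖x‖ → ‖x‖ ≤ 64 → x ∈ VOut)
    (hgIn : ∀ x ∈ VIn, gIn' x = gIn x) (hkIn : ∀ x ∈ VIn, kIn' x = kIn x)
    (hgOut : ∀ x ∈ VOut, gOut' x = gOut x) (hkOut : ∀ x ∈ VOut, kOut' x = kOut x)
    (h : MOTHyp η εo μo gIn kIn gOut kOut sIn sOut) : MOTHyp η εo μo gIn' kIn' gOut' kOut' sIn sOut := by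
  have hAIn' : ∀ x : E3, 1 < ‖x‖ → ‖x‖ < 2 * 1 → x ∈ VIn := fun x h1 h2 ↦ hAIn x h1.le (by linarith)
  have hAOut' : ∀ x : E3, 32 < ‖x‖ → ‖x‖ < 2 * 32 → x ∈ VOut := fun x h1 h2 ↦ hAOut x h1.le (by linarith)
  have h32 : (0 : ℝ) < 32 := by norm_num
  have eE1 : avgE η 1 gIn' = avgE η 1 gIn := avgE_congr hη one_pos hVIn hAIn' hgIn
  have eE32 : avgE η 32 gOut' = avgE η 32 gOut := avgE_congr hη h32 hVOut hAOut' hgOut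
  have eP1 : avgP η 1 kIn' = avgP η 1 kIn := avgP_congr hη one_pos hAIn' hkIn
  have eP32 : avgP η 32 kOut' = avgP η 32 kOut := avgP_congr hη h32 hAOut' hkOut
  have eC1 : avgC η 1 gIn' = avgC η 1 gIn := avgC_congr hη one_pos hVIn hAIn' hgIn
  have eC32 : avgC η 32 gOut' = avgC η 32 gOut := avgC_congr hη h32 hVOut hAOut' hgOut
  have eJ1 : avgJ η 1 kIn' = avgJ η 1 kIn := avgJ_congr hη one_pos hAIn' hkIn
  have eJ32 : avgJ η 32 kOut' = avgJ η 32 kOut := avgJ_congr hη h32 hAOut' hkOut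
  obtain ⟨hdIn, hdOut, hrest⟩ := h
  refine ⟨devLE_congr hVIn hAIn hgIn hkIn hdIn, devLE_congr hVOut hAOut hgOut hkOut hdOut, ?_⟩
  rw [eE1, eE32, eP1, eP32, eC1, eC32, eJ1, eJ32]
  exact hrest

/-! ## §4 The flat in-core; the exact Schwarzschild field -/

/-- The metric coefficient field of the flat vacuum datum IS `flatField`. [folklore] -/
theorem coordH_eq_flatField {F : InitialDataSet (𝓡 3) E3} (hF : FlatVacuumDatum F) : F.coordH = flatField := by
  funext y
  ext v w
  rw [coordH_apply, (hF.1 y v w).1]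
  rfl

/-- The tensor `k` of the flat vacuum datum IS `zeroField`. [folklore] -/
theorem coordK_eq_zeroField {F : InitialDataSet (𝓡 3) E3} (hF : FlatVacuumDatum F) : F.coordK = zeroField :=
  funext fun y ↦ (hF.1 y 0 0).2

/-- The flat pair has deviation `0`. [folklore] -/
theorem devLE_flatField (a b : ℝ) : DevLE flatField zeroField a b 0 := devLE_flat a b

/-- The flat field has averaged energy `0`. [cite: MaoOhTao2023, §1.2 (1.3)] -/
theorem avgE_flatField (η : ℝ → ℝ) (r : ℝ) : avgE η r flatField = 0 := avgE_flat η r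

/-- The flat field has averaged centre of mass `0`. [cite: MaoOhTao2023, §1.2 (1.5)] -/
theorem avgC_flatField (η : ℝ → ℝ) (r : ℝ) (l : Fin 3) : avgC η r flatField l = 0 := avgC_flat η r l

/-- The zero field has averaged linear momentum `0`. [cite: MaoOhTao2023, §1.2 (1.4)] -/
theorem avgP_zeroField (η : ℝ → ℝ) (r : ℝ) (i : Fin 3) : avgP η r zeroField i = 0 := avgP_zero η r i

/-- The zero field has averaged angular momentum `0`. [cite: MaoOhTao2023, §1.2 (1.6)] -/
theorem avgJ_zeroField (η : ℝ → ℝ) (r : ℝ) (l : Fin 3) : avgJ η r zeroField l = 0 := avgJ_zero η r l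

/-- **A Schwarzschild OUT-site accepts the flat IN-core with `sIn = 0`** (all its charges and its deviation vanish).
[cite: MaoOhTao2023, Rem 1.11] -/
theorem motHyp_flat_of_schwOutSite {η : ℝ → ℝ} {εo μo m sOut θ : ℝ} (hsite : SchwOutSite η εo μo m sOut θ)
    (hθ : 0 < θ) {S : InitialDataSet (𝓡 3) E3} (hS : SchwDatum m S) :
    MOTHyp η εo μo flatField zeroField S.coordH S.coordK 0 sOut :=
  hsite S hS flatField zeroField 0 (devLE_flatField 1 2) le_rfl hθ.le
    (by rw [avgE_flatField, abs_zero]; exact hθ.le) (fun i ↦ by rw [avgP_zeroField, abs_zero]; exact hθ.le)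
    (fun i ↦ by rw [avgC_flatField, abs_zero]; exact hθ.le) (fun i ↦ by rw [avgJ_zeroField, abs_zero]; exact hθ.le)

/-- `schwField m y (v, w) = (1 + m/2|y|)⁴ ⟪v, w⟫`. [folklore] -/
theorem schwField_apply (m : ℝ) (y v w : E3) : schwField m y v w = (1 + m / (2 * ‖y‖)) ^ 4 * ⟪v, w⟫_ℝ := rfl

/-- A datum whose metric at `y` is `(1 + m/2|y|)⁴ δ` has `coordH y = schwField m y`. [folklore] -/
theorem coordH_eq_schwField {D : InitialDataSet (𝓡 3) E3} {m : ℝ} {y : E3}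
    (h : ∀ v w : E3, D.h.inner y v w = (1 + m / (2 * ‖y‖)) ^ 4 * ⟪v, w⟫_ℝ) : D.coordH y = schwField m y := by
  ext v w
  rw [coordH_apply, h v w, schwField_apply]

/-! ## §5 Patching finitely many disjoint balls -/

/-- **Patching finitely many disjoint balls.** Given a datum `B` on `ℝ³`, pairwise disjoint balls `B(c_j, R_j)` and data `G′_j`
which agree with `B` off the smaller concentric closed balls `B̄(c_j, r_j)`, `r_j < R_j`, there is a datum `G` on `ℝ³` which is
`G′_j` on `B(c_j, R_j)` and `B` off the closed balls — with the vacuum constraints at such points those of `G′_j`, resp. `B`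
(locality of the constraint map). [cite: BartnikIsenberg2004, §2] -/
theorem exists_patch_balls {ι : Type*} [Fintype ι] (B : InitialDataSet (𝓡 3) E3) (G' : ι → InitialDataSet (𝓡 3) E3)
    (c : ι → E3) (r R : ι → ℝ) (hrR : ∀ j, r j < R j) (hdisj : ∀ i j, i ≠ j → R i + R j ≤ ‖c i - c j‖)
    (hagree : ∀ j y, r j < ‖y - c j‖ → (G' j).SameAt B y) :
    ∃ G : InitialDataSet (𝓡 3) E3,
      (∀ j y, ‖y - c j‖ < R j → G.SameAt (G' j) y) ∧
      (∀ y, (∀ j, r j < ‖y - c j‖) → G.SameAt B y) ∧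
      (∀ j y, ‖y - c j‖ < R j → (VacAt G y ↔ VacAt (G' j) y)) ∧
      (∀ y, (∀ j, r j < ‖y - c j‖) → (VacAt G y ↔ VacAt B y)) := by
  classical
  set hF : E3 → E3 →L[ℝ] E3 →L[ℝ] ℝ := fun y ↦ B.coordH y + ∑ j, ((G' j).coordH y - B.coordH y) with hF_def
  set kF : E3 → E3 →L[ℝ] E3 →L[ℝ] ℝ := fun y ↦ B.coordK y + ∑ j, ((G' j).coordK y - B.coordK y) with kF_def
  have hballo : ∀ j, IsOpen {z : E3 | ‖z - c j‖ < R j} := fun j ↦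
    isOpen_lt (continuous_id.sub continuous_const).norm continuous_const
  have hWo : IsOpen {z : E3 | ∀ j, r j < ‖z - c j‖} := by
    have : {z : E3 | ∀ j, r j < ‖z - c j‖} = ⋂ j, {z | r j < ‖z - c j‖} := by
      ext z
      simp only [mem_setOf_eq, mem_iInter]
    rw [this]
    exact isOpen_iInter_of_finite fun j ↦ isOpen_outside (c j) (r j)
  -- the other balls are far from a point of the ball `j`
  have hfar : ∀ j y, ‖y - c j‖ < R j → ∀ i, i ≠ j → r i < ‖y - c i‖ := by
    intro j y hy i hij
    have h1 := hdisj i j hij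
    have h2 : ‖c i - c j‖ ≤ ‖y - c j‖ + ‖y - c i‖ := by
      calc ‖c i - c j‖ = ‖(y - c j) - (y - c i)‖ := by congr 1; abel
        _ ≤ ‖y - c j‖ + ‖y - c i‖ := norm_sub_le _ _
    linarith [hrR i]
  -- the glued fields on the ball `j` and off the closed balls
  have hball : ∀ j y, ‖y - c j‖ < R j → hF y = (G' j).coordH y ∧ kF y = (G' j).coordK y := by
    intro j y hy
    have hz : ∀ i, i ≠ j → (G' i).coordH y - B.coordH y = 0 ∧ (G' i).coordK y - B.coordK y = 0 := fun i hij ↦ by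
      obtain ⟨hh, hk⟩ := hagree i y (hfar j y hy i hij)
      exact ⟨sub_eq_zero.2 hh, sub_eq_zero.2 hk⟩
    simp only [hF_def, kF_def]
    rw [Finset.sum_eq_single j (fun i _ hij ↦ (hz i hij).1) (fun h ↦ absurd (Finset.mem_univ j) h),
      Finset.sum_eq_single j (fun i _ hij ↦ (hz i hij).2) (fun h ↦ absurd (Finset.mem_univ j) h)]
    constructor <;> abel
  have hoff : ∀ y, (∀ j, r j < ‖y - c j‖) → hF y = B.coordH y ∧ kF y = B.coordK y := by
    intro y hy
    have hz : ∀ i, (G' i).coordH y - B.coordH y = 0 ∧ (G' i).coordK y - B.coordK y = 0 := fun i ↦ by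
      obtain ⟨hh, hk⟩ := hagree i y (hy i)
      exact ⟨sub_eq_zero.2 hh, sub_eq_zero.2 hk⟩
    refine ⟨?_, ?_⟩ <;> simp only [hF_def, kF_def, hz, Finset.sum_const_zero, add_zero]
  -- local models, and the glued datum
  have hloc : ∀ y : E3, ∃ (Dy : InitialDataSet (𝓡 3) E3) (W : Set E3), IsOpen W ∧ y ∈ W ∧
      ∀ z ∈ W, hF z = Dy.h.inner z ∧ kF z = Dy.k z := by
    intro y
    by_cases h : ∃ j, ‖y - c j‖ < R j
    · obtain ⟨j, hj⟩ := h
      exact ⟨G' j, {z | ‖z - c j‖ < R j}, hballo j, hj, fun z hz ↦ hball j z hz⟩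
    · push Not at h
      exact ⟨B, {z | ∀ j, r j < ‖z - c j‖}, hWo, fun j ↦ (hrR j).trans_le (h j), fun z hz ↦ hoff z hz⟩
  obtain ⟨G, hGh, hGk⟩ := exists_initialDataSet_of_localModels hloc
  have hsame1 : ∀ j y, ‖y - c j‖ < R j → G.SameAt (G' j) y := fun j y hy ↦
    ⟨(hGh y).trans (hball j y hy).1, (hGk y).trans (hball j y hy).2⟩
  have hsame2 : ∀ y, (∀ j, r j < ‖y - c j‖) → G.SameAt B y := fun y hy ↦
    ⟨(hGh y).trans (hoff y hy).1, (hGk y).trans (hoff y hy).2⟩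
  refine ⟨G, hsame1, hsame2, fun j y hy ↦ vacAt_congr_nhds ?_, fun y hy ↦ vacAt_congr_nhds ?_⟩
  · filter_upwards [(hballo j).mem_nhds hy] with z hz using hsame1 j z hz
  · filter_upwards [hWo.mem_nhds hy] with z hz using hsame2 z hz

end PlugDataPlus

/-- **Registered anchor of this helper file** (sub-goal `plugDataPlusFromOfAux3_anchor` of stub `stub_plugDataPlusFrom_of`):
affine reading and transplanting for every centre, scale and normalisation, `PlugDataPlus.readTransplantAt_of_pos`.
[cite: BartnikIsenberg2004, §2] -/
theorem plugDataPlusFromOfAux3_anchor : ∀ (G : InitialDataSet (𝓡 3) E3) (c : E3) (s τ : ℝ), 0 < s → 0 < τ → ReadTransplantAt G c s τ :=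
  fun G c _ _ hs hτ ↦ PlugDataPlus.readTransplantAt_of_pos G c hs hτ

/-- **Appendix (2026-08-16), registered sub-goal `plugDataPlus_vacOn_of_vacAt`**: a datum vacuum at every point of `ℝ³` is
vacuum on every annulus. [folklore] -/
theorem plugDataPlus_vacOn_of_vacAt : ∀ (D : InitialDataSet (𝓡 3) E3), (∀ y : E3, VacAt D y) → ∀ a b : ℝ, D.VacOn a b :=
  fun D h a b ↦ (PlugDataPlus.vacOn_iff D a b).2 fun y _ _ ↦ h y

end Summit.FinalStateConjecture.FinalStateConjecture.Theorems.SwallowTheDatum.UniversalWitnessFamily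

end
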